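import Summits.HodgeConjecture.HodgeConjecture.Theorems.F0D9opRoad2BodyGamma   -- ★ previous part of the same Lines workfile `F0D9opRoad2Body` (size-lint split ×4)
import Literature.NumberTheory.Automorphic.Liu2021.AppendixC.RecordHeckePresentation   -- ★ `exists_algPoints_map_eq_of_normal` (replaces the Lines copy `RecordLemmas.exists_map_eq_of_normal`, gate dedup.landed)
import HarnessLib

/-!
# `F0D9opRoad2Body` — ★ RE-HOME of `Lines/F0D9opRoad2Body.lean`, PART 4 of 4 (size-lint split; cut at a declaration boundary).

See PART 1 `Theorems/F0D9opRoad2BodyLetters.lean` for the full re-home header and the original module docstring (verbatim there). Namespaces and sections KEPT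
(re-opened below exactly as they stand at the cut, with their `open`∕`variable` lines replayed); code bytes = the workfile՚s, docstrings included; options preamble repeated from PART 1.
HC_CM is proved only modulo the 7 printed citations (2 remaining: hLiu418 = stmt-HodgeConjecture-24832, h413 = stmt-HodgeConjecture-24833) until rung 0 closes; a re-home is count-neutral. -/

namespace Summit.HodgeConjecture.HodgeConjecture.Cruxes.HLiu418.F0D9opRoad2
set_option linter.dupNamespace false  -- `Summit.HodgeConjecture.HodgeConjecture.…` BY DESIGN (D-0017), as in `Lines/d6_cm_curve.lean`
open CategoryTheory NumberField IsDedekindDomain MulAction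
open scoped Matrix MonObj CategoryTheory.Obj
open MonoidalCategory
open Summit.HodgeConjecture.CorCM.Lines.A3Liu418
open Literature.AlgebraicGeometry.Motives (AbelianVariety)
open Literature.AlgebraicGeometry.Motives.AbelianVariety (rationalTateModuleMap frobeniusHom zsmul_eq_zsmul_trace_comp_of_pin
  exists_finite_forall_exists_goodReductionAt_homReduction_tateSpecialisation)
open Literature.NumberTheory.GaloisRepresentations
open Literature.NumberTheory.Automorphic Literature.NumberTheory.Automorphic.UnitaryGroup
open Literature.AlgebraicGeometry.ShimuraVarieties.UnitaryCanonicalModel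
open Literature.NumberTheory.Automorphic.Liu2021.AppendixC
open Literature.AlgebraicGeometry.Motives (AlgPoints IntegralModel frobeniusOver SchemeOver)
open Literature.NumberTheory.DiophantineGeometry (geomResidueField)

section Edition5Desk
open Literature.NumberTheory.EllipticCurves (genericFibre)
open Literature.NumberTheory.DiophantineGeometry (specialFibreFunctor)
open IsLocalRing (closedPoint)


/-! #### ED. 5 DESK v0.2 — `section RecordLemmas` (F0P5a-p05 (g3), row (b9); record currency u1 + u4, INLINED from the HOME desks
Γ3-Q `Gamma3Q-PROOF-DESK.v0` 263db0a2 §B–§C and DESC-H `DESC-H-RECORD-DESK.v0.1` 376282d0 §A–§C under the LINE-LOCAL namespace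
`…F0D9opRoad2.RecordLemmas` so that a later Literature filing on P6 day cannot clash by FQN; the registrar deletes this section and imports
then).  Inputs ★: p805003∕p807651 `Motives/SepQuotientIntermediateFibres` (§4 finite-index form, §5 reindexing), p807653
`AppendixC/SmallLevelTrace`, `UnitaryShimuraCurveRecordMorphisms` (GS-2b), `UnitaryShimuraCurveHeckeHolds` (u4), `BettiPinningHeckeEndomorphism`
(`exists_normal_le_forall_heckeLE`), `RestOneLevelInvariants` (`exists_le_le`, `exists_normal_le`), `HeckeAlgebra` (`finite_orbit_quotient`). -/

namespace RecordLemmas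

open AlgebraicGeometry Literature.AlgebraicGeometry.Motives

variable {F : Type} [Field F] [NumberField F] [IsCMField F] {Jstar : Matrix (Fin 2) (Fin 2) F} {ι₁ : F →+* ℂ}
  {K₀ : C5.OpenCompactSubgroup ↥(finAdelic ↥(maximalRealSubfield F) F (IsCMField.complexConj F) 2 Jstar)}
  (S : RecordSystemGS F Jstar ι₁ K₀)

/-- `T_k^{N→K₁} ≫ u^{K₁}_K = u^N_K` for `k ∈ K` (GS-2b). -/
theorem heckeTranslate_comp_map_eq_map {N K₁ K : C5.SmallLevel K₀} (hle : K₁ ≤ K) (hNK : N ≤ K) {k : ↥(finAdelic ↥(maximalRealSubfield F) F (IsCMField.complexConj F) 2 Jstar)} (hk : k ∈ K.1.1)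
    {T : S.M.obj N ⟶ S.M.obj K₁} (hT : S.IsHeckeTranslate N K₁ k T) :
    T ≫ S.M.map (homOfLE hle) = S.M.map (homOfLE hNK) := by
  have h₁ : S.IsHeckeTranslate N K (k * 1) (T ≫ S.M.map (homOfLE hle)) :=
    S.isHeckeTranslate_comp hT (S.isHeckeTranslate_one_map (homOfLE hle))
  have h₂ : S.IsHeckeTranslate N K (1 * k) (S.M.map (homOfLE hNK) ≫ 𝟙 _) :=
    S.isHeckeTranslate_comp (S.isHeckeTranslate_one_map (homOfLE hNK)) (S.isHeckeTranslate_id_of_mem K hk)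
  rw [mul_one] at h₁
  rw [one_mul, Category.comp_id] at h₂
  exact S.heckeTranslate_unique h₁ h₂

/-- `T_k^{N→K₁} ≫ T_t^{K₁→K} = T_r^{N→K}` when `r ∈ k t K` (GS-2b). -/
theorem heckeTranslate_comp_heckeTranslate_eq {N K₁ K : C5.SmallLevel K₀} {k t r : ↥(finAdelic ↥(maximalRealSubfield F) F (IsCMField.complexConj F) 2 Jstar)} (hk' : (k * t)⁻¹ * r ∈ K.1.1)
    {T : S.M.obj N ⟶ S.M.obj K₁} (hT : S.IsHeckeTranslate N K₁ k T)
    {Tt : S.M.obj K₁ ⟶ S.M.obj K} (hTt : S.IsHeckeTranslate K₁ K t Tt)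
    {Tr : S.M.obj N ⟶ S.M.obj K} (hTr : S.IsHeckeTranslate N K r Tr) : T ≫ Tt = Tr := by
  have h₁ : S.IsHeckeTranslate N K (k * t * ((k * t)⁻¹ * r)) ((T ≫ Tt) ≫ 𝟙 _) :=
    S.isHeckeTranslate_comp (S.isHeckeTranslate_comp hT hTt) (S.isHeckeTranslate_id_of_mem K hk')
  rw [mul_inv_cancel_left, Category.comp_id] at h₁
  exact S.heckeTranslate_unique h₁ hTr

/-! **`exists_map_eq_of_normal` — NOT RESTATED IN THE ★ RE-HOME (gate `dedup.landed`, A-p14 (g39) dry-run 2026-09-02T10:14Z):** the Lines original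
(`RecordLemmas.exists_map_eq_of_normal`, :906–:920 of `Lines/F0D9opRoad2Body.lean`) is statement-identical to ★
`Literature.NumberTheory.Automorphic.Liu2021.AppendixC.exists_algPoints_map_eq_of_normal` [`RecordHeckePresentation`], same explicit arguments
`(S) (hLQ) (hN'N) (hn) (x)`; the two call sites below use the ★ name (module imported above). A `Lines/` shim of this workfile must alias the old FQN
if any reader wants it (none in the tree today). -/

/-- **The `u′`-fibre over `u x` on geometric points consists of translates** (Γ3-Q desk §B): every `y ∈ M⋆_{K₁}(Ω)` with `u′ y = u x` is
`T_k x` for all `k ∈ K` with `k⁻¹g⁻¹ ∈ K₁`, for some `g ∈ K` (★ §4 `map_eq_map_iff_exists_eq_map_act_of_finiteIndex` at a normal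
`N′ ≤ N ⊓ K₁`, ★ §5 `IsSepQuotient.of_forall_exists`, GS-2b). -/
theorem exists_mem_forall_heckeTranslate_map_eq (hLQ : S.IsLevelQuotient) {Ω : Type} [Field Ω] [Algebra F Ω] [IsAlgClosed Ω]
    {N K₁ K : C5.SmallLevel K₀} (hle : K₁ ≤ K) (hNK : N ≤ K) (x : AlgPoints (S.M.obj N) Ω) (y : AlgPoints (S.M.obj K₁) Ω)
    (hy : AlgPoints.map (S.M.map (homOfLE hle)) y = AlgPoints.map (S.M.map (homOfLE hNK)) x) :
    ∃ g ∈ K.1.1, ∀ (k : ↥(finAdelic ↥(maximalRealSubfield F) F (IsCMField.complexConj F) 2 Jstar)), k⁻¹ * g⁻¹ ∈ K₁.1.1 → ∀ (T : S.M.obj N ⟶ S.M.obj K₁), S.IsHeckeTranslate N K₁ k T → AlgPoints.map T x = y := by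
  have hNK' : (N.1.1 : Subgroup _) ≤ K.1.1 := hNK
  have hle' : (K₁.1.1 : Subgroup _) ≤ K.1.1 := hle
  obtain ⟨L, hL⟩ := C5.SmallLevel.exists_le_le N K₁
  obtain ⟨N', hN'⟩ := C5.SmallLevel.exists_normal_le K L
  have hN'K : N' ≤ K := hN'.1
  have hn' : ∀ k ∈ K.1.1, C5.HeckeLE k N' N' := hN'.2.2
  have hN'N : N' ≤ N := hN'.2.1.trans hL.1
  have hN'K₁ : N' ≤ K₁ := hN'.2.1.trans hL.2
  have hn'K₁ : ∀ k ∈ K₁.1.1, C5.HeckeLE k N' N' := fun k hk => hn' k (hle' hk)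
  have hn'N : ∀ k ∈ N.1.1, C5.HeckeLE k N' N' := fun k hk => hn' k (hNK' hk)
  obtain ⟨act, hact'⟩ := hLQ hN'K (fun k hk n hn => hn' k hk n hn)
  obtain ⟨act₁, hact₁'⟩ := hLQ hN'K₁ (fun k hk n hn => hn'K₁ k hk n hn)
  have hact := hact'.1
  have hact₁ := hact₁'.1
  haveI := C5.SmallLevel.normal_subgroupOf_of_heckeLE N' K hn'
  haveI := C5.SmallLevel.finiteIndex_subgroupOf N' K
  have hXN' : IsProjectiveOver (S.M.obj N') := S.projective N'
  have hsep : ∀ A : C5.SmallLevel K₀, IsSeparated (S.M.obj A).hom := fun A => by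
    haveI : IsProper (S.M.obj A).hom := (S.projective A).isProper
    infer_instance
  obtain ⟨x', hx⟩ := Literature.NumberTheory.Automorphic.Liu2021.AppendixC.exists_algPoints_map_eq_of_normal S hLQ hN'N hn'N x
  subst hx
  have hker : ∀ n ∈ (N'.1.1 : Subgroup _).subgroupOf K.1.1, act n = 1 := fun n hn =>
    RecordSystemGS.IsLevelQuotient.act_eq_one_of_mem hact n (Subgroup.mem_subgroupOf.1 hn)
  have hq : IsSepQuotient (fun h : ↥((K₁.1.1 : Subgroup _).subgroupOf K.1.1) => act h) (S.M.map (homOfLE hN'K₁)) := by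
    let e : ↥((K₁.1.1 : Subgroup ↥(finAdelic ↥(maximalRealSubfield F) F (IsCMField.complexConj F) 2 Jstar)).subgroupOf K.1.1) → ↥(K₁.1.1 : Subgroup ↥(finAdelic ↥(maximalRealSubfield F) F (IsCMField.complexConj F) 2 Jstar)) := fun h =>
      ⟨((h : ↥(K.1.1 : Subgroup ↥(finAdelic ↥(maximalRealSubfield F) F (IsCMField.complexConj F) 2 Jstar))) : ↥(finAdelic ↥(maximalRealSubfield F) F (IsCMField.complexConj F) 2 Jstar)), Subgroup.mem_subgroupOf.1 h.2⟩
    let e' : ↥(K₁.1.1 : Subgroup ↥(finAdelic ↥(maximalRealSubfield F) F (IsCMField.complexConj F) 2 Jstar)) → ↥((K₁.1.1 : Subgroup ↥(finAdelic ↥(maximalRealSubfield F) F (IsCMField.complexConj F) 2 Jstar)).subgroupOf K.1.1) := fun k₁ =>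
      ⟨⟨(k₁ : ↥(finAdelic ↥(maximalRealSubfield F) F (IsCMField.complexConj F) 2 Jstar)), hle' k₁.2⟩, Subgroup.mem_subgroupOf.2 k₁.2⟩
    have key : ∀ h : ↥((K₁.1.1 : Subgroup ↥(finAdelic ↥(maximalRealSubfield F) F (IsCMField.complexConj F) 2 Jstar)).subgroupOf K.1.1), act (h : ↥(K.1.1 : Subgroup ↥(finAdelic ↥(maximalRealSubfield F) F (IsCMField.complexConj F) 2 Jstar))) = act₁ (e h) :=
      fun h => Iso.ext (S.heckeTranslate_unique (hact _) (hact₁ _))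
    have key' : ∀ k₁ : ↥(K₁.1.1 : Subgroup ↥(finAdelic ↥(maximalRealSubfield F) F (IsCMField.complexConj F) 2 Jstar)), act₁ k₁ = act (e' k₁ : ↥(K.1.1 : Subgroup ↥(finAdelic ↥(maximalRealSubfield F) F (IsCMField.complexConj F) 2 Jstar))) :=
      fun k₁ => Iso.ext (S.heckeTranslate_unique (hact₁ _) (hact _))
    exact IsSepQuotient.of_forall_exists (act := fun k₁ : ↥(K₁.1.1 : Subgroup ↥(finAdelic ↥(maximalRealSubfield F) F (IsCMField.complexConj F) 2 Jstar)) => act₁ k₁)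
      (act' := fun h : ↥((K₁.1.1 : Subgroup ↥(finAdelic ↥(maximalRealSubfield F) F (IsCMField.complexConj F) 2 Jstar)).subgroupOf K.1.1) => act (h : ↥(K.1.1 : Subgroup ↥(finAdelic ↥(maximalRealSubfield F) F (IsCMField.complexConj F) 2 Jstar))))
      (fun h => ⟨e h, key h⟩) (fun k₁ => ⟨e' k₁, key' k₁⟩) hact₁'.2
  have hqr : S.M.map (homOfLE hN'K₁) ≫ S.M.map (homOfLE hle) = S.M.map (homOfLE hN'K) := by
    rw [← Functor.map_comp]
    rfl
  have hy' : AlgPoints.map (S.M.map (homOfLE hle)) y = AlgPoints.map (S.M.map (homOfLE hN'K)) x' := by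
    rw [hy, ← AlgPoints.map_comp_apply, ← Functor.map_comp]
    rfl
  obtain ⟨g, hg⟩ := (map_eq_map_iff_exists_eq_map_act_of_finiteIndex (algebraMap F Ω) act
    ((K₁.1.1 : Subgroup _).subgroupOf K.1.1) ((N'.1.1 : Subgroup _).subgroupOf K.1.1)
    (S.M.map (homOfLE hN'K)) (S.M.map (homOfLE hN'K₁)) (S.M.map (homOfLE hle)) hXN' (hsep K) (hsep K₁) hker hact'.2 hq hqr
    x' y).1 hy'
  have hg' : y = AlgPoints.map (S.M.map (homOfLE hN'K₁)) (AlgPoints.map (act g).hom x') := hg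
  refine ⟨(g : ↥(finAdelic ↥(maximalRealSubfield F) F (IsCMField.complexConj F) 2 Jstar)), g.2, fun k hκ T hT => ?_⟩
  have h₁ : S.IsHeckeTranslate N' K₁ (1 * k * (k⁻¹ * ((g : ↥(finAdelic ↥(maximalRealSubfield F) F (IsCMField.complexConj F) 2 Jstar)))⁻¹)) ((S.M.map (homOfLE hN'N) ≫ T) ≫ 𝟙 _) :=
    S.isHeckeTranslate_comp (S.isHeckeTranslate_comp (S.isHeckeTranslate_one_map (homOfLE hN'N)) hT)
      (S.isHeckeTranslate_id_of_mem K₁ hκ)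
  have h₂ : S.IsHeckeTranslate N' K₁ (((g : ↥(finAdelic ↥(maximalRealSubfield F) F (IsCMField.complexConj F) 2 Jstar)))⁻¹ * 1) ((act g).hom ≫ S.M.map (homOfLE hN'K₁)) :=
    S.isHeckeTranslate_comp (hact g) (S.isHeckeTranslate_one_map (homOfLE hN'K₁))
  rw [Category.comp_id, one_mul, mul_inv_cancel_left] at h₁
  rw [mul_one] at h₂
  have hmor : S.M.map (homOfLE hN'N) ≫ T = (act g).hom ≫ S.M.map (homOfLE hN'K₁) := S.heckeTranslate_unique h₁ h₂
  calc AlgPoints.map T (AlgPoints.map (S.M.map (homOfLE hN'N)) x')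
      = AlgPoints.map (S.M.map (homOfLE hN'N) ≫ T) x' := (AlgPoints.map_comp_apply _ _ _).symm
    _ = AlgPoints.map ((act g).hom ≫ S.M.map (homOfLE hN'K₁)) x' := by rw [hmor]
    _ = y := by rw [hg', AlgPoints.map_comp_apply]

/-- **Γ3-Q generic** (Γ3-Q desk §C): the surjection `lift : K t K / K ↠ u′-fibre over u x` with `T_t (lift α) = T_{r₁ α} x`. -/
theorem exists_heckeSum_lift (hU7ₛ : S.HeckeTranslateDefinedOver) (hLQ : S.IsLevelQuotient)
    {Ω : Type} [Field Ω] [Algebra F Ω] [IsAlgClosed Ω] (t : ↥(finAdelic ↥(maximalRealSubfield F) F (IsCMField.complexConj F) 2 Jstar)) (K K₁ N : C5.SmallLevel K₀) (hle : K₁ ≤ K)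
    (hK₁ : (K₁.1.1 : Subgroup ↥(finAdelic ↥(maximalRealSubfield F) F (IsCMField.complexConj F) 2 Jstar)) = K.1.1 ⊓ (K.1.1).map (MulAut.conj t).toMonoidHom) (hNK : N ≤ K)
    (r₁ : orbit (K.1.1 : Subgroup ↥(finAdelic ↥(maximalRealSubfield F) F (IsCMField.complexConj F) 2 Jstar)) ((t : ↥(finAdelic ↥(maximalRealSubfield F) F (IsCMField.complexConj F) 2 Jstar)) : ↥(finAdelic ↥(maximalRealSubfield F) F (IsCMField.complexConj F) 2 Jstar) ⧸ (K.1.1 : Subgroup ↥(finAdelic ↥(maximalRealSubfield F) F (IsCMField.complexConj F) 2 Jstar))) → ↥(finAdelic ↥(maximalRealSubfield F) F (IsCMField.complexConj F) 2 Jstar))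
    (hr₁ : ∀ α, ((r₁ α : ↥(finAdelic ↥(maximalRealSubfield F) F (IsCMField.complexConj F) 2 Jstar)) : ↥(finAdelic ↥(maximalRealSubfield F) F (IsCMField.complexConj F) 2 Jstar) ⧸ (K.1.1 : Subgroup ↥(finAdelic ↥(maximalRealSubfield F) F (IsCMField.complexConj F) 2 Jstar))) = α.1) (hrN₁ : ∀ α, C5.HeckeLE (r₁ α) N K)
    {Tt : S.M.obj K₁ ⟶ S.M.obj K} (hTt : S.IsHeckeTranslate K₁ K t Tt)
    {Tr : orbit (K.1.1 : Subgroup ↥(finAdelic ↥(maximalRealSubfield F) F (IsCMField.complexConj F) 2 Jstar)) ((t : ↥(finAdelic ↥(maximalRealSubfield F) F (IsCMField.complexConj F) 2 Jstar)) : ↥(finAdelic ↥(maximalRealSubfield F) F (IsCMField.complexConj F) 2 Jstar) ⧸ (K.1.1 : Subgroup ↥(finAdelic ↥(maximalRealSubfield F) F (IsCMField.complexConj F) 2 Jstar))) → (S.M.obj N ⟶ S.M.obj K)}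
    (hTr : ∀ α, S.IsHeckeTranslate N K (r₁ α) (Tr α)) (x : AlgPoints (S.M.obj N) Ω) :
    ∃ lift : orbit (K.1.1 : Subgroup ↥(finAdelic ↥(maximalRealSubfield F) F (IsCMField.complexConj F) 2 Jstar)) ((t : ↥(finAdelic ↥(maximalRealSubfield F) F (IsCMField.complexConj F) 2 Jstar)) : ↥(finAdelic ↥(maximalRealSubfield F) F (IsCMField.complexConj F) 2 Jstar) ⧸ (K.1.1 : Subgroup ↥(finAdelic ↥(maximalRealSubfield F) F (IsCMField.complexConj F) 2 Jstar))) →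
        {y : AlgPoints (S.M.obj K₁) Ω // AlgPoints.map (S.M.map (homOfLE hle)) y = AlgPoints.map (S.M.map (homOfLE hNK)) x},
      Function.Surjective lift ∧ ∀ α, AlgPoints.map Tt (lift α).1 = AlgPoints.map (Tr α) x := by
  have hNK' : (N.1.1 : Subgroup _) ≤ K.1.1 := hNK
  have hα : ∀ α : orbit (K.1.1 : Subgroup ↥(finAdelic ↥(maximalRealSubfield F) F (IsCMField.complexConj F) 2 Jstar)) ((t : ↥(finAdelic ↥(maximalRealSubfield F) F (IsCMField.complexConj F) 2 Jstar)) : ↥(finAdelic ↥(maximalRealSubfield F) F (IsCMField.complexConj F) 2 Jstar) ⧸ (K.1.1 : Subgroup ↥(finAdelic ↥(maximalRealSubfield F) F (IsCMField.complexConj F) 2 Jstar))),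
      ∃ kα : ↥(finAdelic ↥(maximalRealSubfield F) F (IsCMField.complexConj F) 2 Jstar), kα ∈ K.1.1 ∧ ((kα * t : ↥(finAdelic ↥(maximalRealSubfield F) F (IsCMField.complexConj F) 2 Jstar)) : ↥(finAdelic ↥(maximalRealSubfield F) F (IsCMField.complexConj F) 2 Jstar) ⧸ (K.1.1 : Subgroup ↥(finAdelic ↥(maximalRealSubfield F) F (IsCMField.complexConj F) 2 Jstar))) = α.1 := by
    intro α
    obtain ⟨m, hm⟩ := MulAction.mem_orbit_iff.1 α.2
    refine ⟨(m : ↥(finAdelic ↥(maximalRealSubfield F) F (IsCMField.complexConj F) 2 Jstar)), m.2, ?_⟩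
    rw [← hm]
    rfl
  choose kα hkαK hkα using hα
  have hk' : ∀ α, (kα α * t)⁻¹ * r₁ α ∈ K.1.1 := fun α => by
    rw [← QuotientGroup.eq, hkα α, hr₁ α]
  have hLE : ∀ α, C5.HeckeLE (kα α) N K₁ := fun α =>
    C5.conj_mem_inf_map_conj hK₁ hNK' (hkαK α) (hk' α) (hrN₁ α)
  choose Tk hTk using fun α => hU7ₛ (kα α) N K₁ (hLE α)
  refine ⟨fun α => ⟨AlgPoints.map (Tk α) x, by
      rw [← AlgPoints.map_comp_apply, heckeTranslate_comp_map_eq_map S hle hNK (hkαK α) (hTk α)]⟩, ?_, fun α => by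
    change AlgPoints.map Tt (AlgPoints.map (Tk α) x) = _
    rw [← AlgPoints.map_comp_apply, heckeTranslate_comp_heckeTranslate_eq S (hk' α) (hTk α) hTt (hTr α)]⟩
  rintro ⟨y, hy⟩
  obtain ⟨g, hg⟩ := exists_mem_forall_heckeTranslate_map_eq S hLQ hle hNK x y hy
  let α : orbit (K.1.1 : Subgroup ↥(finAdelic ↥(maximalRealSubfield F) F (IsCMField.complexConj F) 2 Jstar)) ((t : ↥(finAdelic ↥(maximalRealSubfield F) F (IsCMField.complexConj F) 2 Jstar)) : ↥(finAdelic ↥(maximalRealSubfield F) F (IsCMField.complexConj F) 2 Jstar) ⧸ (K.1.1 : Subgroup ↥(finAdelic ↥(maximalRealSubfield F) F (IsCMField.complexConj F) 2 Jstar))) :=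
    ⟨((g⁻¹ * t : ↥(finAdelic ↥(maximalRealSubfield F) F (IsCMField.complexConj F) 2 Jstar)) : ↥(finAdelic ↥(maximalRealSubfield F) F (IsCMField.complexConj F) 2 Jstar) ⧸ (K.1.1 : Subgroup ↥(finAdelic ↥(maximalRealSubfield F) F (IsCMField.complexConj F) 2 Jstar))), MulAction.mem_orbit_iff.2 ⟨⟨g, hg.1⟩⁻¹, rfl⟩⟩
  have hκ : (kα α * t)⁻¹ * (g⁻¹ * t) ∈ K.1.1 := by
    rw [← QuotientGroup.eq, hkα α]
  exact ⟨α, Subtype.ext (hg.2 (kα α) (C5.inv_mul_inv_mem_of_conj hK₁ (hkαK α) hg.1 hκ) (Tk α) (hTk α))⟩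

/-- **Translates with the same `K`-coset agree after `u_{Kc→K}`** (DESC-H desk §B; GS-2b). -/
theorem map_heckeTranslate_map_eq_of_coset_eq {Ω : Type} [Field Ω] [Algebra F Ω]
    {N' N Kc K : C5.SmallLevel K₀} (hN'N : N' ≤ N) (hKcK : Kc ≤ K) {r rc : ↥(finAdelic ↥(maximalRealSubfield F) F (IsCMField.complexConj F) 2 Jstar)}
    (h : ((rc : ↥(finAdelic ↥(maximalRealSubfield F) F (IsCMField.complexConj F) 2 Jstar)) : ↥(finAdelic ↥(maximalRealSubfield F) F (IsCMField.complexConj F) 2 Jstar) ⧸ (K.1.1 : Subgroup ↥(finAdelic ↥(maximalRealSubfield F) F (IsCMField.complexConj F) 2 Jstar))) = ((r : ↥(finAdelic ↥(maximalRealSubfield F) F (IsCMField.complexConj F) 2 Jstar)) : ↥(finAdelic ↥(maximalRealSubfield F) F (IsCMField.complexConj F) 2 Jstar) ⧸ (K.1.1 : Subgroup ↥(finAdelic ↥(maximalRealSubfield F) F (IsCMField.complexConj F) 2 Jstar))))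
    {T : S.M.obj N ⟶ S.M.obj K} (hT : S.IsHeckeTranslate N K r T)
    {Tc : S.M.obj N' ⟶ S.M.obj Kc} (hTc : S.IsHeckeTranslate N' Kc rc Tc) (x' : AlgPoints (S.M.obj N') Ω) :
    AlgPoints.map T (AlgPoints.map (S.M.map (homOfLE hN'N)) x') = AlgPoints.map (S.M.map (homOfLE hKcK)) (AlgPoints.map Tc x') := by
  have hmem : rc⁻¹ * r ∈ K.1.1 := QuotientGroup.eq.1 h
  have h₁ : S.IsHeckeTranslate N' K (1 * r) (S.M.map (homOfLE hN'N) ≫ T) :=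
    S.isHeckeTranslate_comp (S.isHeckeTranslate_one_map (homOfLE hN'N)) hT
  have h₂ : S.IsHeckeTranslate N' K (rc * 1 * (rc⁻¹ * r)) ((Tc ≫ S.M.map (homOfLE hKcK)) ≫ 𝟙 _) :=
    S.isHeckeTranslate_comp (S.isHeckeTranslate_comp hTc (S.isHeckeTranslate_one_map (homOfLE hKcK)))
      (S.isHeckeTranslate_id_of_mem K hmem)
  rw [one_mul] at h₁
  rw [mul_one, mul_inv_cancel_left, Category.comp_id] at h₂
  rw [← AlgPoints.map_comp_apply, ← AlgPoints.map_comp_apply, S.heckeTranslate_unique h₁ h₂]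

/-- **A common deep level** below `N`, `Kc` and finitely many conjugates, normalised by `K` (DESC-H desk §A). -/
theorem exists_deep_level (s : Finset ↥(finAdelic ↥(maximalRealSubfield F) F (IsCMField.complexConj F) 2 Jstar)) (N K Kc : C5.SmallLevel K₀) :
    ∃ N' : C5.SmallLevel K₀, N' ≤ N ∧ N' ≤ Kc ∧ (∀ k ∈ K.1.1, C5.HeckeLE k N' N') ∧ ∀ gm ∈ s, C5.HeckeLE gm N' Kc := by
  obtain ⟨M, hM⟩ := C5.SmallLevel.exists_normal_le_forall_heckeLE s Kc
  obtain ⟨L, hL⟩ := C5.SmallLevel.exists_le_le N M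
  obtain ⟨N', hN'⟩ := C5.SmallLevel.exists_normal_le K L
  exact ⟨N', hN'.2.1.trans hL.1, (hN'.2.1.trans hL.2).trans hM.1, hN'.2.2,
    fun gm hgm => (hM.2.2 gm hgm).of_le_left (hN'.2.1.trans hL.2)⟩

/-- **DESC-H generic** (DESC-H desk §C): the ∃-body of `HeckeMultisetLevelDescent` with `recordHeckeTranslateGS S hU7ₛ ↦ tr`, generic in
`t₁ t₂` and in the (b6) coset bijections. -/
theorem exists_heckeMultisetLevelDescent (hLQ : S.IsLevelQuotient)
    (tr : ∀ (g : ↥(finAdelic ↥(maximalRealSubfield F) F (IsCMField.complexConj F) 2 Jstar)) (A B : C5.SmallLevel K₀), C5.HeckeLE g A B → (S.M.obj A ⟶ S.M.obj B))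
    (htr : ∀ (g : ↥(finAdelic ↥(maximalRealSubfield F) F (IsCMField.complexConj F) 2 Jstar)) (A B : C5.SmallLevel K₀) (h : C5.HeckeLE g A B), S.IsHeckeTranslate A B g (tr g A B h))
    {Ω : Type} [Field Ω] [Algebra F Ω] [IsAlgClosed Ω]
    (t₁ t₂ : ↥(finAdelic ↥(maximalRealSubfield F) F (IsCMField.complexConj F) 2 Jstar)) {K Kc N : C5.SmallLevel K₀} (hKcK : Kc ≤ K) (hNK : N ≤ K)
    (hex₁ : ∃ e₁ : ↥(orbit (K.1.1 : Subgroup ↥(finAdelic ↥(maximalRealSubfield F) F (IsCMField.complexConj F) 2 Jstar)) (t₁ : ↥(finAdelic ↥(maximalRealSubfield F) F (IsCMField.complexConj F) 2 Jstar) ⧸ (K.1.1 : Subgroup ↥(finAdelic ↥(maximalRealSubfield F) F (IsCMField.complexConj F) 2 Jstar)))) ≃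
          ↥(orbit (Kc.1.1 : Subgroup ↥(finAdelic ↥(maximalRealSubfield F) F (IsCMField.complexConj F) 2 Jstar)) (t₁ : ↥(finAdelic ↥(maximalRealSubfield F) F (IsCMField.complexConj F) 2 Jstar) ⧸ (Kc.1.1 : Subgroup ↥(finAdelic ↥(maximalRealSubfield F) F (IsCMField.complexConj F) 2 Jstar)))),
        ∀ α (g : ↥(finAdelic ↥(maximalRealSubfield F) F (IsCMField.complexConj F) 2 Jstar)), (g : ↥(finAdelic ↥(maximalRealSubfield F) F (IsCMField.complexConj F) 2 Jstar) ⧸ (Kc.1.1 : Subgroup ↥(finAdelic ↥(maximalRealSubfield F) F (IsCMField.complexConj F) 2 Jstar))) = (e₁ α).1 → (g : ↥(finAdelic ↥(maximalRealSubfield F) F (IsCMField.complexConj F) 2 Jstar) ⧸ (K.1.1 : Subgroup ↥(finAdelic ↥(maximalRealSubfield F) F (IsCMField.complexConj F) 2 Jstar))) = α.1)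
    (hex₂ : ∃ e₂ : ↥(orbit (K.1.1 : Subgroup ↥(finAdelic ↥(maximalRealSubfield F) F (IsCMField.complexConj F) 2 Jstar)) (t₂ : ↥(finAdelic ↥(maximalRealSubfield F) F (IsCMField.complexConj F) 2 Jstar) ⧸ (K.1.1 : Subgroup ↥(finAdelic ↥(maximalRealSubfield F) F (IsCMField.complexConj F) 2 Jstar)))) ≃
          ↥(orbit (Kc.1.1 : Subgroup ↥(finAdelic ↥(maximalRealSubfield F) F (IsCMField.complexConj F) 2 Jstar)) (t₂ : ↥(finAdelic ↥(maximalRealSubfield F) F (IsCMField.complexConj F) 2 Jstar) ⧸ (Kc.1.1 : Subgroup ↥(finAdelic ↥(maximalRealSubfield F) F (IsCMField.complexConj F) 2 Jstar)))),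
        ∀ α (g : ↥(finAdelic ↥(maximalRealSubfield F) F (IsCMField.complexConj F) 2 Jstar)), (g : ↥(finAdelic ↥(maximalRealSubfield F) F (IsCMField.complexConj F) 2 Jstar) ⧸ (Kc.1.1 : Subgroup ↥(finAdelic ↥(maximalRealSubfield F) F (IsCMField.complexConj F) 2 Jstar))) = (e₂ α).1 → (g : ↥(finAdelic ↥(maximalRealSubfield F) F (IsCMField.complexConj F) 2 Jstar) ⧸ (K.1.1 : Subgroup ↥(finAdelic ↥(maximalRealSubfield F) F (IsCMField.complexConj F) 2 Jstar))) = α.1)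
    (r₁ : ↥(orbit (K.1.1 : Subgroup ↥(finAdelic ↥(maximalRealSubfield F) F (IsCMField.complexConj F) 2 Jstar)) (t₁ : ↥(finAdelic ↥(maximalRealSubfield F) F (IsCMField.complexConj F) 2 Jstar) ⧸ (K.1.1 : Subgroup ↥(finAdelic ↥(maximalRealSubfield F) F (IsCMField.complexConj F) 2 Jstar)))) → ↥(finAdelic ↥(maximalRealSubfield F) F (IsCMField.complexConj F) 2 Jstar))
    (hr₁ : ∀ α, ((r₁ α : ↥(finAdelic ↥(maximalRealSubfield F) F (IsCMField.complexConj F) 2 Jstar)) : ↥(finAdelic ↥(maximalRealSubfield F) F (IsCMField.complexConj F) 2 Jstar) ⧸ (K.1.1 : Subgroup ↥(finAdelic ↥(maximalRealSubfield F) F (IsCMField.complexConj F) 2 Jstar))) = α.1) (hrN₁ : ∀ α, C5.HeckeLE (r₁ α) N K)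
    (r₂ : ↥(orbit (K.1.1 : Subgroup ↥(finAdelic ↥(maximalRealSubfield F) F (IsCMField.complexConj F) 2 Jstar)) (t₂ : ↥(finAdelic ↥(maximalRealSubfield F) F (IsCMField.complexConj F) 2 Jstar) ⧸ (K.1.1 : Subgroup ↥(finAdelic ↥(maximalRealSubfield F) F (IsCMField.complexConj F) 2 Jstar)))) → ↥(finAdelic ↥(maximalRealSubfield F) F (IsCMField.complexConj F) 2 Jstar))
    (hr₂ : ∀ α, ((r₂ α : ↥(finAdelic ↥(maximalRealSubfield F) F (IsCMField.complexConj F) 2 Jstar)) : ↥(finAdelic ↥(maximalRealSubfield F) F (IsCMField.complexConj F) 2 Jstar) ⧸ (K.1.1 : Subgroup ↥(finAdelic ↥(maximalRealSubfield F) F (IsCMField.complexConj F) 2 Jstar))) = α.1) (hrN₂ : ∀ α, C5.HeckeLE (r₂ α) N K)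
    (x : AlgPoints (S.M.obj N) Ω) :
    ∃ (N' : C5.SmallLevel K₀) (hN'N : N' ≤ N) (_ : N' ≤ Kc) (x' : AlgPoints (S.M.obj N') Ω)
      (_ : AlgPoints.map (S.M.map (homOfLE hN'N)) x' = x)
      (rc₁ : ↥(orbit (Kc.1.1 : Subgroup ↥(finAdelic ↥(maximalRealSubfield F) F (IsCMField.complexConj F) 2 Jstar)) (t₁ : ↥(finAdelic ↥(maximalRealSubfield F) F (IsCMField.complexConj F) 2 Jstar) ⧸ (Kc.1.1 : Subgroup ↥(finAdelic ↥(maximalRealSubfield F) F (IsCMField.complexConj F) 2 Jstar)))) → ↥(finAdelic ↥(maximalRealSubfield F) F (IsCMField.complexConj F) 2 Jstar))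
      (_ : ∀ β, ((rc₁ β : ↥(finAdelic ↥(maximalRealSubfield F) F (IsCMField.complexConj F) 2 Jstar)) : ↥(finAdelic ↥(maximalRealSubfield F) F (IsCMField.complexConj F) 2 Jstar) ⧸ (Kc.1.1 : Subgroup ↥(finAdelic ↥(maximalRealSubfield F) F (IsCMField.complexConj F) 2 Jstar))) = β.1) (hrcN₁ : ∀ β, C5.HeckeLE (rc₁ β) N' Kc)
      (rc₂ : ↥(orbit (Kc.1.1 : Subgroup ↥(finAdelic ↥(maximalRealSubfield F) F (IsCMField.complexConj F) 2 Jstar)) (t₂ : ↥(finAdelic ↥(maximalRealSubfield F) F (IsCMField.complexConj F) 2 Jstar) ⧸ (Kc.1.1 : Subgroup ↥(finAdelic ↥(maximalRealSubfield F) F (IsCMField.complexConj F) 2 Jstar)))) → ↥(finAdelic ↥(maximalRealSubfield F) F (IsCMField.complexConj F) 2 Jstar))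
      (_ : ∀ β, ((rc₂ β : ↥(finAdelic ↥(maximalRealSubfield F) F (IsCMField.complexConj F) 2 Jstar)) : ↥(finAdelic ↥(maximalRealSubfield F) F (IsCMField.complexConj F) 2 Jstar) ⧸ (Kc.1.1 : Subgroup ↥(finAdelic ↥(maximalRealSubfield F) F (IsCMField.complexConj F) 2 Jstar))) = β.1) (hrcN₂ : ∀ β, C5.HeckeLE (rc₂ β) N' Kc)
      (e₁ : ↥(orbit (K.1.1 : Subgroup ↥(finAdelic ↥(maximalRealSubfield F) F (IsCMField.complexConj F) 2 Jstar)) (t₁ : ↥(finAdelic ↥(maximalRealSubfield F) F (IsCMField.complexConj F) 2 Jstar) ⧸ (K.1.1 : Subgroup ↥(finAdelic ↥(maximalRealSubfield F) F (IsCMField.complexConj F) 2 Jstar)))) ≃ ↥(orbit (Kc.1.1 : Subgroup ↥(finAdelic ↥(maximalRealSubfield F) F (IsCMField.complexConj F) 2 Jstar)) (t₁ : ↥(finAdelic ↥(maximalRealSubfield F) F (IsCMField.complexConj F) 2 Jstar) ⧸ (Kc.1.1 : Subgroup ↥(finAdelic ↥(maximalRealSubfield F) F (IsCMField.complexConj F)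 2 Jstar)))))
      (e₂ : ↥(orbit (K.1.1 : Subgroup ↥(finAdelic ↥(maximalRealSubfield F) F (IsCMField.complexConj F) 2 Jstar)) (t₂ : ↥(finAdelic ↥(maximalRealSubfield F) F (IsCMField.complexConj F) 2 Jstar) ⧸ (K.1.1 : Subgroup ↥(finAdelic ↥(maximalRealSubfield F) F (IsCMField.complexConj F) 2 Jstar)))) ≃ ↥(orbit (Kc.1.1 : Subgroup ↥(finAdelic ↥(maximalRealSubfield F) F (IsCMField.complexConj F) 2 Jstar)) (t₂ : ↥(finAdelic ↥(maximalRealSubfield F) F (IsCMField.complexConj F) 2 Jstar) ⧸ (Kc.1.1 : Subgroup ↥(finAdelic ↥(maximalRealSubfield F) F (IsCMField.complexConj F) 2 Jstar))))),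
      (∀ α, AlgPoints.map (tr (r₁ α) N K (hrN₁ α)) x
          = AlgPoints.map (S.M.map (homOfLE hKcK)) (AlgPoints.map (tr (rc₁ (e₁ α)) N' Kc (hrcN₁ (e₁ α))) x')) ∧
      (∀ α, AlgPoints.map (tr (r₂ α) N K (hrN₂ α)) x
          = AlgPoints.map (S.M.map (homOfLE hKcK)) (AlgPoints.map (tr (rc₂ (e₂ α)) N' Kc (hrcN₂ (e₂ α))) x')) := by
  classical
  obtain ⟨e₁, he₁⟩ := hex₁
  obtain ⟨e₂, he₂⟩ := hex₂
  have hNK' : (N.1.1 : Subgroup _) ≤ K.1.1 := hNK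
  let rc₁ : ↥(orbit (Kc.1.1 : Subgroup ↥(finAdelic ↥(maximalRealSubfield F) F (IsCMField.complexConj F) 2 Jstar)) (t₁ : ↥(finAdelic ↥(maximalRealSubfield F) F (IsCMField.complexConj F) 2 Jstar) ⧸ (Kc.1.1 : Subgroup ↥(finAdelic ↥(maximalRealSubfield F) F (IsCMField.complexConj F) 2 Jstar)))) → ↥(finAdelic ↥(maximalRealSubfield F) F (IsCMField.complexConj F) 2 Jstar) := fun β => Quotient.out β.1
  let rc₂ : ↥(orbit (Kc.1.1 : Subgroup ↥(finAdelic ↥(maximalRealSubfield F) F (IsCMField.complexConj F) 2 Jstar)) (t₂ : ↥(finAdelic ↥(maximalRealSubfield F) F (IsCMField.complexConj F) 2 Jstar) ⧸ (Kc.1.1 : Subgroup ↥(finAdelic ↥(maximalRealSubfield F) F (IsCMField.complexConj F) 2 Jstar)))) → ↥(finAdelic ↥(maximalRealSubfield F) F (IsCMField.complexConj F) 2 Jstar) := fun β => Quotient.out β.1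
  have hrc₁ : ∀ β, ((rc₁ β : ↥(finAdelic ↥(maximalRealSubfield F) F (IsCMField.complexConj F) 2 Jstar)) : ↥(finAdelic ↥(maximalRealSubfield F) F (IsCMField.complexConj F) 2 Jstar) ⧸ (Kc.1.1 : Subgroup ↥(finAdelic ↥(maximalRealSubfield F) F (IsCMField.complexConj F) 2 Jstar))) = β.1 := fun β => QuotientGroup.out_eq' β.1
  have hrc₂ : ∀ β, ((rc₂ β : ↥(finAdelic ↥(maximalRealSubfield F) F (IsCMField.complexConj F) 2 Jstar)) : ↥(finAdelic ↥(maximalRealSubfield F) F (IsCMField.complexConj F) 2 Jstar) ⧸ (Kc.1.1 : Subgroup ↥(finAdelic ↥(maximalRealSubfield F) F (IsCMField.complexConj F) 2 Jstar))) = β.1 := fun β => QuotientGroup.out_eq' β.1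
  haveI := Literature.NumberTheory.Automorphic.isHeckeTriple_top_of_isCompact_isOpen (Kc.1.1 : Subgroup ↥(finAdelic ↥(maximalRealSubfield F) F (IsCMField.complexConj F) 2 Jstar)) Kc.1.2.2 Kc.1.2.1
  haveI hfin₁ := (Literature.NumberTheory.Automorphic.finite_orbit_quotient (Kc.1.1 : Subgroup ↥(finAdelic ↥(maximalRealSubfield F) F (IsCMField.complexConj F) 2 Jstar)) t₁).to_subtype
  haveI hfin₂ := (Literature.NumberTheory.Automorphic.finite_orbit_quotient (Kc.1.1 : Subgroup ↥(finAdelic ↥(maximalRealSubfield F) F (IsCMField.complexConj F) 2 Jstar)) t₂).to_subtype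
  letI := Fintype.ofFinite ↥(orbit (Kc.1.1 : Subgroup ↥(finAdelic ↥(maximalRealSubfield F) F (IsCMField.complexConj F) 2 Jstar)) (t₁ : ↥(finAdelic ↥(maximalRealSubfield F) F (IsCMField.complexConj F) 2 Jstar) ⧸ (Kc.1.1 : Subgroup ↥(finAdelic ↥(maximalRealSubfield F) F (IsCMField.complexConj F) 2 Jstar))))
  letI := Fintype.ofFinite ↥(orbit (Kc.1.1 : Subgroup ↥(finAdelic ↥(maximalRealSubfield F) F (IsCMField.complexConj F) 2 Jstar)) (t₂ : ↥(finAdelic ↥(maximalRealSubfield F) F (IsCMField.complexConj F) 2 Jstar) ⧸ (Kc.1.1 : Subgroup ↥(finAdelic ↥(maximalRealSubfield F) F (IsCMField.complexConj F) 2 Jstar))))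
  have hlev := exists_deep_level (Finset.univ.image rc₁ ∪ Finset.univ.image rc₂) N K Kc
  obtain ⟨N', hN'⟩ := hlev
  have hN'N : N' ≤ N := hN'.1
  have hN'Kc : N' ≤ Kc := hN'.2.1
  have hn' : ∀ k ∈ K.1.1, C5.HeckeLE k N' N' := hN'.2.2.1
  have hs : ∀ gm ∈ Finset.univ.image rc₁ ∪ Finset.univ.image rc₂, C5.HeckeLE gm N' Kc := hN'.2.2.2
  have hrcN₁ : ∀ β, C5.HeckeLE (rc₁ β) N' Kc := fun β =>
    hs _ (Finset.mem_union_left _ (Finset.mem_image_of_mem rc₁ (Finset.mem_univ β)))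
  have hrcN₂ : ∀ β, C5.HeckeLE (rc₂ β) N' Kc := fun β =>
    hs _ (Finset.mem_union_right _ (Finset.mem_image_of_mem rc₂ (Finset.mem_univ β)))
  have hlift := Literature.NumberTheory.Automorphic.Liu2021.AppendixC.exists_algPoints_map_eq_of_normal S hLQ hN'N (fun k hk => hn' k (hNK' hk)) x
  obtain ⟨x', hx'⟩ := hlift
  refine ⟨N', hN'N, hN'Kc, x', hx', rc₁, hrc₁, hrcN₁, rc₂, hrc₂, hrcN₂, e₁, e₂, fun α => ?_, fun α => ?_⟩
  · rw [← hx']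
    exact map_heckeTranslate_map_eq_of_coset_eq S hN'N hKcK ((he₁ α (rc₁ (e₁ α)) (hrc₁ (e₁ α))).trans (hr₁ α).symm)
      (htr _ _ _ (hrN₁ α)) (htr _ _ _ (hrcN₁ (e₁ α))) x'
  · rw [← hx']
    exact map_heckeTranslate_map_eq_of_coset_eq S hN'N hKcK ((he₂ α (rc₂ (e₂ α)) (hrc₂ (e₂ α))).trans (hr₂ α).symm)
      (htr _ _ _ (hrN₂ α)) (htr _ _ _ (hrcN₂ (e₂ α))) x'

end RecordLemmas

end Edition5Desk

end Summit.HodgeConjecture.HodgeConjecture.Cruxes.HLiu418.F0D9opRoad2
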